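import Summits.QuantumAdvantage.AdviceFreeQNC0.FibreDecimation37NHFibre
import Summits.QuantumAdvantage.AdviceFreeQNC0.FibreDecimation37SpreadCount
import HarnessLib

/-!
# Cell qa-qnc0, `p = 3` — ROUND-37P2 §2: **Theorem 37.F (`FibreNonExact37`, constant targets, hypothesis (Gen_d)) for `m ≥ 3`**

Planner qa-qnc0-p2 g37, ROUND-37P2 §2 Theorem 37.F, typed verbatim as `Exp37.FibreNonExact37` (`FibreDecimation37.lean`): if the
dense test `k₀` carries the nowhere-zero pattern `a` on the `m` chosen coins (`m` odd) and the decimated code is (Gen_d) — minimum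
`Y`-distance `d` with `(5/3)^{|J|}(2^{−d} + (√3/2)^{|Y|}) ≤ 1/20` — then the parity of the tests agrees with any CONSTANT on at most
`(1 − 2^{−(m+2)})·2^{z−1}` points of the parity coset.

* **`fibreNonExact37_of_three_le`** — the typed statement plus `3 ≤ m` (at `m = 1` the typed statement fails exactly as
  `FibreNonExact37NH` does, see `FibreDecimation37NH.lean`).  Same pipeline as 37.F′: STEP 1 injection, STEP 2 `good_fibre_parity`
  (a constant target is the affine target `(b, ∅)`), STEP 3 in the `L¹` form `card_parityClass_filter_le_of_spread` (`≤ (3/4)·2^{|Y|−1}`,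
  whence the better constant `2^{−(m+2)}`).

WHAT THIS IS NOT: Corollary 37.C (the residual core for decimation-generic `L`) and the random-`L` count are untouched; crux 22907 untouched.
-/

noncomputable section

namespace Summit.QuantumAdvantage.AdviceFreeQNC0.Exp37

open Finset
open Summit.QuantumAdvantage.AdviceFreeQNC0 F4
open Literature.Computability.MetaComplexity Literature.Computability.MetaComplexity.ModTestProduct

/-- A constant target is the affine target `(b, ∅)`: `testParity = b % 2 ↔ testParity % 2 = affTarget b ∅ % 2`. -/
theorem testParity_eq_iff_affTarget_empty {z s : ℕ} (β : Fin s → Fin z → ZMod 3) (r : Fin s → ZMod 3) (b : ℕ)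
    (u : Fin z → Bool) : testParity β r u = b % 2 ↔ testParity β r u % 2 = affTarget b ∅ u % 2 := by
  unfold testParity affTarget
  rw [Finset.filter_empty, Finset.card_empty, add_zero, Nat.mod_mod]

/-- **Theorem 37.F (ROUND-37P2 §2, constant targets under (Gen_d)) for odd `m ≥ 3` — PROVED.** -/
theorem fibreNonExact37_of_three_le (z s m d : ℕ) (ι : Fin m ↪ Fin z) (β : Fin s → Fin z → ZMod 3)
    (r : Fin s → ZMod 3) (k₀ : Fin s) (a : Fin m → Bool) (hm : Odd m) (h3 : 3 ≤ m) (hz : 1 ≤ z - m)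
    (hβ : ∀ i, β k₀ (ι i) = lettZ (a i)) (hG : GenD ι a β d) (ε b : ℕ) :
    (((coset z ε).filter fun u => testParity β r u = b % 2).card : ℝ)
      ≤ (1 - (2 : ℝ)⁻¹ ^ (m + 2)) * (2 : ℝ) ^ (z - 1) := by
  classical
  -- the coset, its agreement and disagreement parts
  set agree : (Fin z → Bool) → Prop := fun u => testParity β r u = b % 2 with hagree
  have hHcard : ((coset z ε).card : ℝ) = (2 : ℝ) ^ (z - 1) := by
    have hc := card_parityClass (ι := Fin z) (by rw [Fintype.card_fin]; omega) ε
    rw [Fintype.card_fin] at hc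
    exact hc
  have hsplitH := card_filter_add_card_filter_not (s := coset z ε) agree
  set D : Finset (Fin z → Bool) := (coset z ε).filter fun u => ¬ agree u with hD
  -- the outside cube and its even half
  have hn : Fintype.card (Out ι) = z - m := card_out ι
  have hnpos : 0 < Fintype.card (Out ι) := by rw [hn]; exact hz
  set Yev : Finset (Out ι → Bool) := univ.filter fun y => (univ.filter fun c => y c = true).card % 2 = 0 % 2 with hYev
  have hYcard : (Yev.card : ℝ) = (2 : ℝ) ^ (z - m - 1) := by
    rw [← hn]; exact card_parityClass hnpos 0
  -- STEP 1
  set res : (Fin z → Bool) → (Out ι → Bool) := fun u c => u c.1 with hres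
  set Bset : Finset (Out ι → Bool) := Yev.filter fun y => ∃ u ∈ D, res u = y with hBset
  set Good : Finset (Out ι → Bool) := Yev.filter fun y => ¬ ∃ u ∈ D, res u = y with hGood
  have hsplitY := card_filter_add_card_filter_not (s := Yev) (fun y => ∃ u ∈ D, res u = y)
  have hBD : Bset.card ≤ D.card := by
    refine Finset.card_le_card_of_injOn
      (fun y => if hy : ∃ u ∈ D, res u = y then hy.choose else fun _ => false) (fun y hy => ?_) ?_
    · obtain ⟨-, hy'⟩ := mem_filter.1 hy
      simp only [dif_pos hy']
      exact hy'.choose_spec.1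
    · intro y hy y' hy' heq
      obtain ⟨-, h1⟩ := mem_filter.1 (mem_coe.1 hy)
      obtain ⟨-, h1'⟩ := mem_filter.1 (mem_coe.1 hy')
      simp only [dif_pos h1, dif_pos h1'] at heq
      calc y = res h1.choose := h1.choose_spec.2.symm
        _ = res h1'.choose := by rw [heq]
        _ = y' := h1'.choose_spec.2
  -- STEP 2 + 3
  have hGoodP : Good ⊆ univ.filter fun y : Out ι → Bool =>
      (univ.filter fun c => y c = true).card % 2 = 0 % 2 ∧
        (univ.filter fun k => subsetSum (dirOut ι β k) y ∈ accSet ι β r a ε k).card % 2 = cStar ι a ε ∅ % 2 := by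
    intro y hy
    obtain ⟨hyev, hgood⟩ := mem_filter.1 hy
    obtain ⟨-, hy0⟩ := mem_filter.1 hyev
    refine mem_filter.2 ⟨mem_univ _, hy0, ?_⟩
    refine good_fibre_parity ι β r a b ε ∅ hm y (by omega) fun u hu hres' => ?_
    rw [← testParity_eq_iff_affTarget_empty]
    by_contra hne
    exact hgood ⟨u, mem_filter.2 ⟨hu, hne⟩, hres'⟩
  obtain ⟨hk₀, hk₀'⟩ := accSet_pattern_genuine ι β r a ε hm (by omega) k₀ hβ
  obtain ⟨hGd, hGnum⟩ := hG
  have hd : ∀ j : Fin s → ZMod 3, j ≠ 0 → (∀ k, k ∉ decimSet ι a β → j k = 0) →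
      d ≤ ModTestProduct.wt (combo (dirOut ι β) j) := by
    intro j hj hsupp
    rw [wt_combo_dirOut]
    exact hGd j hj hsupp
  rw [← hn] at hGnum
  have hP := card_parityClass_filter_le_of_spread (dirOut ι β) (accSet ι β r a ε) (decimSet ι a β)
    (accSet_eq_empty_of_not_mem_decimSet ι β r a ε hm) k₀ hk₀ hk₀' hnpos hd hGnum 0 (cStar ι a ε ∅)
  rw [hn] at hP
  have hGoodNat : Good.card ≤ _ := card_le_card hGoodP
  have hGood : (Good.card : ℝ) ≤ 3 / 4 * (2 : ℝ) ^ (z - m - 1) := (Nat.cast_le.2 hGoodNat).trans hP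
  -- assembly
  have hsplitHR : (((coset z ε).filter agree).card : ℝ) + (D.card : ℝ) = (2 : ℝ) ^ (z - 1) := by
    rw [← hHcard]; exact_mod_cast hsplitH
  have hsplitYR : (Bset.card : ℝ) + (Good.card : ℝ) = (2 : ℝ) ^ (z - m - 1) := by
    rw [← hYcard]; exact_mod_cast hsplitY
  have hBDR : (Bset.card : ℝ) ≤ (D.card : ℝ) := by exact_mod_cast hBD
  have hpow : (2 : ℝ) ^ (z - 1) = (2 : ℝ) ^ m * (2 : ℝ) ^ (z - m - 1) := by
    rw [← pow_add]; congr 1; omega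
  have hinv : (2 : ℝ)⁻¹ ^ (m + 2) * ((2 : ℝ) ^ m * (2 : ℝ) ^ (z - m - 1)) = (2 : ℝ) ^ (z - m - 1) / 4 := by
    obtain ⟨X, hX⟩ : ∃ X : ℝ, X = (2 : ℝ)⁻¹ ^ (m + 2) := ⟨_, rfl⟩
    have h1 : X * (2 : ℝ) ^ (m + 2) = 1 := by
      rw [hX, ← mul_pow]; norm_num
    have h24 : (2 : ℝ) ^ (m + 2) = (2 : ℝ) ^ m * 4 := by rw [pow_add]; norm_num
    rw [h24] at h1
    rw [← hX]
    calc X * ((2 : ℝ) ^ m * (2 : ℝ) ^ (z - m - 1)) = X * ((2 : ℝ) ^ m * 4) * (2 : ℝ) ^ (z - m - 1) / 4 := by ring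
      _ = (2 : ℝ) ^ (z - m - 1) / 4 := by rw [h1, one_mul]
  rw [show (((coset z ε).filter fun u => testParity β r u = b % 2).card : ℝ) =
      (((coset z ε).filter agree).card : ℝ) from rfl]
  rw [hpow, sub_mul, one_mul, hinv]
  linarith

end Summit.QuantumAdvantage.AdviceFreeQNC0.Exp37

end
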